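import Literature.NumberTheory.Weil1964.UnitaryArchLocalTopFormHaar     -- ★ p844350 A-p06 (g28) U1 FILE B: `skewC`, `traceFormC`, `lieGramC`, `lieFinBasisC`, `lieGramDetC`, `lieStdLebesgueC`, `skewMulLC`, `cayleyWeightC`
import Literature.NumberTheory.Weil1964.UnitaryArchTopFormHaar          -- ★ A-p19 (g20) D-T3′: `archSkew`-side `traceForm`, `lieGram`, `lieFinBasis`, `lieGramDet`, `lieStdLebesgue` (+ ★ `skewMulL`, `cayleyWeight`)
import Mathlib.LinearAlgebra.StdBasis
import HarnessLib

/-!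
# (U) ROAD U2, FILE E — the canonical Lebesgue measure, the Cayley weight and the Gram non-degeneracy of `𝔲(J)` SPLIT ALONG THE PLACES:
# `e_* lieStdLebesgue = ⊗_i lieStdLebesgueC`, `cayleyWeight = ∏_i cayleyWeightC`, `lieGramDet ≠ 0 ⇒ lieGramDetC ≠ 0` for ANY splitting `e : 𝔲(J) ≃ Π_i 𝔲(J_i)`
# compatible with the trace form and the Cayley multiplication (Rogawski 1990 §1.7; Macdonald 1980)

Topic `NumberTheory/Weil1964`; namespace `Literature.NumberTheory.Weil1964.UnitaryArchTopForm`.  THEOREMS ONLY (no definition, no instance, no notation, no named fact,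
no `sorry`); kernel lane.  Cell `pub/hodgecm-mathlib` (D-0151), crux H413 = `stmt-HodgeConjecture-24833` (supports only); ROAD (U) (LEAD F0P3a-plan (g10) WORDS T9-32 (4) ∕
T9-36; owner A-p19 (g24) `ROAD-U-v1` c65f2c35; U1 ★ A-p06 (g28) p844327∕p844350∕p844375; U2 HEAD `map_archPiEquivCM_archTopFormHaar` = A-p06 (g28), who SHED this file
(12:50:52Z) to A-p12 (g20); owner's nod 12:53:39Z).  DESIGN (A-p12 12:57Z): (E1)–(E3) are proved ABSTRACTLY in the splitting — for any finite index type `ι`, any family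
`Jw : ι → M_N(ℂ)` and any continuous linear equivalence `e : 𝔲(J) ≃L[ℝ] Π_i 𝔲(Jw i)` satisfying the two laws of A-p06's FILE D (`htr`: the trace form is the sum of
the place trace forms through `e`; `hmul`: `e` intertwines `skewMulL` with the product of the `skewMulLC`) — so this file does not import FILE D; FILE F instantiates
`e := skewPiEquiv`, `htr := traceForm_eq_sum_traceFormC`, `hmul := skewPiEquiv_skewMulL`.
HONEST LABEL: HC_CM is proved only modulo the cell's 2 remaining named inputs (hLiu418, h413) until rung 0 closes; this file is measure-theoretic bookkeeping over Mathlib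
(`Basis.addHaar`, `Measure.pi`) and pays no letter by itself.

THE MATHEMATICS.  §0 (folklore, generic): the parallelepiped of the assembled basis `Pi.basis b` of `Π_i E_i` is the product of the parallelepipeds
(`coe_parallelepiped_pi_basis`), hence **`(Pi.basis b).addHaar = Measure.pi (fun i => (b i).addHaar)`** (`pi_basis_addHaar`; Mathlib has the binary `Basis.prod_addHaar`
only); `Measure.pi (c • μ) = (∏ c) • Measure.pi μ` (`pi_smul_measure`); and, for linear maps of DIFFERENT finite free modules, `det(⊕_i f_i) = ∏_i det f_i` through
`det (blockDiagonal' d) = ∏ det d_i` (private copies adapted from ★ `HodgeStructureEndActionCharpolyFactorFields`; Mathlib's `det_blockDiagonal`∕`LinearMap.det_pi` are the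
equal-block cases).  §1 Given `e` and `htr`: pull the assembled basis `Pi.basis (lieFinBasisC ∘ Jw)` back along `e` to a basis `B` of `𝔲(J)`; its trace-form Gram matrix is
`blockDiagonal' (lieGramC (lieFinBasisC (Jw i)))` (cross-place entries vanish by `htr`), so `det = ∏_i lieGramDetC (Jw i)` (`det_lieGram_pullback_pi_basis`); with ★
`lieStdLebesgue_eq_smul_addHaar B` (basis-freeness), `Basis.map_addHaar`, §0 and `√|∏| = ∏ √|·|`:
**(E1) `map_lieStdLebesgue_eq_pi`**: `e_* (lieStdLebesgue J) = Measure.pi (lieStdLebesgueC ∘ Jw)`; and **(E3) `lieGramDetC_ne_zero_of_lieGramDet_ne_zero`** (a non-zero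
product has non-zero factors; `lieGramDet` and `det Gram(B)` differ by `det(P)² ≠ 0`, ★ `lieGram_basis_change`).  §2 Given `hmul`: `skewMulL X = e⁻¹ ∘ (⊕_i skewMulLC (e X i)) ∘ e`,
so `det (skewMulL X) = ∏_i det (skewMulLC (e X i))` (`LinearMap.det_conj` + §0) and **(E2) `cayleyWeight_eq_prod`**: `cayleyWeight X = ∏_i cayleyWeightC (e X i)`.

## References
* [Rogawski1990] J. D. Rogawski, *Automorphic Representations of Unitary Groups in Three Variables*, Ann. of Math. Stud. 123 (1990): §1.7 p. 6 (`dg = |Ω|_v`, product over places).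
* [Macdonald1980] I. G. Macdonald, *The volume of a compact Lie group*, Invent. Math. 56 (1980), 93–95 (trace-form normalisation).
* [Folland1995] G. B. Folland, *A Course in Abstract Harmonic Analysis* (1995), §2.2 (Haar measure on products; uniqueness).
* [Knapp2002] A. W. Knapp, *Lie Groups Beyond an Introduction*, 2nd ed. (2002), VIII §2 (Lebesgue measure from a basis; change of basis).
-/

set_option autoImplicit false
-- the scoped normed structure on the submodules `𝔲 ≤ M_N` is only reducibly defeq to the subtype uniformity ∕ topology carried by the `[BorelSpace ↥…]` binders
-- (as in ★ `UnitaryArchTopFormHaar`, ★ `UnitaryArchLocalTopFormHaar`)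
set_option backward.isDefEq.respectTransparency false

noncomputable section

open Set MeasureTheory MeasureTheory.Measure NumberField NumberField.mixedEmbedding Module
open Literature.NumberTheory.Automorphic Literature.NumberTheory.Automorphic.UnitaryGroup
open scoped Classical Matrix Matrix.Norms.Operator MatrixGroups ENNReal NNReal Pointwise

namespace Literature.NumberTheory.Weil1964

namespace UnitaryArchTopForm

open UnitaryArchLocalTopForm

/-! ## §0 Folklore: assembled bases of `Π_i E_i` — parallelepiped, Lebesgue measure, scalar factors; block determinants of different sizes -/

section PiBasis

variable {ι : Type*} [Fintype ι] [DecidableEq ι] {E : ι → Type*} [∀ i, NormedAddCommGroup (E i)] [∀ i, NormedSpace ℝ (E i)]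
  {κ : ι → Type*} [∀ i, Fintype (κ i)]

/-- Coordinates of a combination of the assembled basis `Pi.basis b`: the `j`-th component only sees the `j`-th block. [cite: Knapp2002, VIII §2] -/
theorem sum_smul_pi_basis_apply (b : ∀ i, Basis (κ i) ℝ (E i)) (t : (Σ i, κ i) → ℝ) (j : ι) :
    (∑ p : Σ i, κ i, t p • (Pi.basis b) p) j = ∑ k : κ j, t ⟨j, k⟩ • b j k := by
  rw [Finset.sum_apply, Fintype.sum_sigma]
  rw [Finset.sum_eq_single j]
  · refine Finset.sum_congr rfl fun k _ => ?_
    rw [Pi.smul_apply, Pi.basis_apply, Pi.single_eq_same]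
  · intro i _ hij
    refine Finset.sum_eq_zero fun k _ => ?_
    rw [Pi.smul_apply, Pi.basis_apply, Pi.single_eq_of_ne (Ne.symm hij), smul_zero]
  · intro h; exact absurd (Finset.mem_univ j) h

/-- **The parallelepiped of the assembled basis is the product of the parallelepipeds** (Mathlib: `Basis.prod_parallelepiped` for two factors). [cite: Knapp2002, VIII §2] -/
theorem coe_parallelepiped_pi_basis (b : ∀ i, Basis (κ i) ℝ (E i)) :
    ((Pi.basis b).parallelepiped : Set (∀ i, E i)) = Set.pi univ fun i => ((b i).parallelepiped : Set (E i)) := by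
  ext x
  simp only [Basis.coe_parallelepiped, mem_parallelepiped_iff, Set.mem_univ_pi]
  constructor
  · rintro ⟨t, ht, rfl⟩ j
    refine ⟨fun k => t ⟨j, k⟩, ⟨fun k => ht.1 _, fun k => ht.2 _⟩, ?_⟩
    rw [sum_smul_pi_basis_apply]
  · intro h
    choose t ht hx using h
    refine ⟨fun p => t p.1 p.2, ⟨fun p => (ht p.1).1 _, fun p => (ht p.1).2 _⟩, ?_⟩
    funext j
    rw [sum_smul_pi_basis_apply]
    exact hx j

variable [∀ i, MeasurableSpace (E i)] [∀ i, BorelSpace (E i)] [∀ i, SecondCountableTopology (E i)]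

/-- **The Lebesgue measure of the assembled basis is the product of the Lebesgue measures**: `(Pi.basis b).addHaar = ⊗_i (b i).addHaar` (both are additive Haar measures
giving mass `1` to the product parallelepiped; Mathlib: `Basis.prod_addHaar` for two factors). [cite: Folland1995, §2.2] [cite: Knapp2002, VIII §2] -/
theorem pi_basis_addHaar (b : ∀ i, Basis (κ i) ℝ (E i)) :
    (Pi.basis b).addHaar = Measure.pi fun i => (b i).addHaar := by
  have : ∀ i, FiniteDimensional ℝ (E i) := fun i => (b i).finiteDimensional_of_finite
  rw [Basis.addHaar_eq_iff, coe_parallelepiped_pi_basis, Measure.pi_pi]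
  refine Finset.prod_eq_one fun i _ => ?_
  rw [Basis.coe_parallelepiped]
  exact (b i).addHaar_self

end PiBasis

section PiSmul

variable {ι : Type*} [Fintype ι] {α : ι → Type*} [∀ i, MeasurableSpace (α i)]

/-- `Measure.pi (c • μ) = (∏ c) • Measure.pi μ` for non-negative real constants (agreement on rectangles, `Measure.pi_eq`). [cite: Folland1995, §2.2] -/
theorem pi_smul_measure (μ : ∀ i, Measure (α i)) [∀ i, SigmaFinite (μ i)] (c : ι → ℝ≥0) :
    Measure.pi (fun i => c i • μ i) = (∏ i, (c i : ℝ≥0∞)) • Measure.pi μ := by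
  refine (Measure.pi_eq fun s _ => ?_)
  rw [Measure.smul_apply, smul_eq_mul, Measure.pi_pi, ← Finset.prod_mul_distrib]
  refine Finset.prod_congr rfl fun i _ => ?_
  rw [Measure.coe_nnreal_smul_apply]

end PiSmul

section PiDet

variable {K : Type*} [CommRing K]

-- adapted from ★ Literature/AlgebraicGeometry/Motives/HodgeStructureEndActionCharpolyFactorFields.lean (:121, private there)
/-- `det (blockDiagonal' d) = ∏ₖ det dₖ` for square blocks of DIFFERENT sizes (Mathlib's `Matrix.det_blockDiagonal` is the equal-size case). [cite: Knapp2002, VIII §2] -/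
theorem det_blockDiagonal'_pi {κ : Type*} [Fintype κ] [DecidableEq κ] {σ : κ → Type*} [∀ k, Fintype (σ k)] [∀ k, DecidableEq (σ k)]
    (d : ∀ k, Matrix (σ k) (σ k) K) : (Matrix.blockDiagonal' d).det = ∏ k, (d k).det := by
  let e := Fintype.equivFin κ
  have hT : (Matrix.blockDiagonal' d).BlockTriangular (fun a : Σ j, σ j => e a.1) := by
    rintro ⟨i, x⟩ ⟨j, y⟩ h
    exact Matrix.blockDiagonal'_apply_ne d x y fun hij => absurd (congrArg (⇑e) hij.symm) (ne_of_lt h)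
  rw [hT.det_fintype]
  refine (Fintype.prod_equiv e (fun k => (d k).det) _ fun k => ?_).symm
  let f₀ : σ k ≃ {a : Σ j, σ j // a.1 = k} :=
    { toFun := fun x => ⟨⟨k, x⟩, rfl⟩
      invFun := fun a => a.2 ▸ a.1.2
      left_inv := fun _ => rfl
      right_inv := by
        rintro ⟨⟨j, x⟩, h⟩
        subst h
        rfl }
  let f : σ k ≃ {a : Σ j, σ j // e a.1 = e k} := f₀.trans (Equiv.subtypeEquivRight fun a => e.injective.eq_iff.symm)
  rw [Matrix.toSquareBlock_def, ← Matrix.det_submatrix_equiv_self f]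
  congr 1
  ext x y
  simp only [Matrix.submatrix_apply]
  exact (Matrix.blockDiagonal'_apply_eq d k x y).symm

variable {ι : Type*} [Fintype ι] [DecidableEq ι] {M : ι → Type*} [∀ i, AddCommGroup (M i)] [∀ i, Module K (M i)]

-- adapted from ★ Literature/AlgebraicGeometry/Motives/HodgeStructureEndActionCharpolyFactorFields.lean (:172, private there)
/-- In the assembled basis of `Πᵢ Mᵢ`, `⊕ᵢ fᵢ` has the matrix `blockDiagonal' (matrix of fᵢ)`. [cite: Knapp2002, VIII §2] -/
theorem toMatrix_pi_eq_blockDiagonal'_pi {κ : ι → Type*} [∀ i, Fintype (κ i)] [∀ i, DecidableEq (κ i)]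
    (b : ∀ i, Module.Basis (κ i) K (M i)) (f : ∀ i, M i →ₗ[K] M i) :
    LinearMap.toMatrix (Pi.basis b) (Pi.basis b) (LinearMap.pi fun i => (f i).comp (LinearMap.proj i)) =
      Matrix.blockDiagonal' fun i => LinearMap.toMatrix (b i) (b i) (f i) := by
  ext ⟨s, i⟩ ⟨s', j⟩
  rw [LinearMap.toMatrix_apply, Pi.basis_apply, Pi.basis_repr]
  simp only [LinearMap.pi_apply, LinearMap.comp_apply, LinearMap.proj_apply]
  by_cases h : s = s'
  · subst h
    rw [Matrix.blockDiagonal'_apply_eq, Pi.single_eq_same, LinearMap.toMatrix_apply]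
  · rw [Matrix.blockDiagonal'_apply_ne _ _ _ h, Pi.single_eq_of_ne h, map_zero, map_zero, Finsupp.zero_apply]

variable [∀ i, Module.Free K (M i)] [∀ i, Module.Finite K (M i)]

-- adapted from ★ Literature/AlgebraicGeometry/Motives/HodgeStructureEndActionCharpolyFactorFields.lean (:196, private there)
/-- `det(⊕ᵢ fᵢ) = ∏ᵢ det fᵢ` for endomorphisms of finite free modules of DIFFERENT ranks (Mathlib's `LinearMap.det_pi` is the constant-fibre case). [cite: Knapp2002, VIII §2] -/
theorem det_pi_pi (f : ∀ i, M i →ₗ[K] M i) :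
    LinearMap.det (LinearMap.pi fun i => (f i).comp (LinearMap.proj i) : Module.End K (Π i, M i)) = ∏ i, LinearMap.det (f i) := by
  classical
  let b := fun i => Module.Free.chooseBasis K (M i)
  rw [← LinearMap.det_toMatrix (Pi.basis b), toMatrix_pi_eq_blockDiagonal'_pi, det_blockDiagonal'_pi]
  exact Finset.prod_congr rfl fun i _ => LinearMap.det_toMatrix _ _

end PiDet

/-! ## §1 The trace-form Gram matrix and the canonical Lebesgue measure along a splitting `e : 𝔲(J) ≃ Π_i 𝔲(Jw i)` -/

section Splitting

variable {F E : Type} [Field F] [Field E] [NumberField E] [Algebra F E] {c : E ≃ₐ[F] E} {N : ℕ} {J : Matrix (Fin N) (Fin N) E}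
  {ι : Type} [Fintype ι] [DecidableEq ι] {Jw : ι → Matrix (Fin N) (Fin N) ℂ}

/-- **THE GRAM MATRIX OF A PULLED-BACK ASSEMBLED BASIS IS BLOCK-DIAGONAL**: if the trace form splits through `e` (`htr`), then for bases `b i` of the `𝔲(Jw i)` the basis
`B := (Pi.basis b).map e⁻¹` of `𝔲(J)` has `Gram(B) = blockDiagonal' (Gram(b i))`. [cite: Macdonald1980, p. 93] [cite: Rogawski1990, §1.7 p. 6] -/
theorem lieGram_pullback_pi_basis_eq (e : archSkew F E c N J ≃L[ℝ] (∀ i, skewC N (Jw i)))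
    (htr : ∀ X Y : archSkew F E c N J, traceForm E N (X : Matrix (Fin N) (Fin N) (mixedSpace E)) (Y : Matrix (Fin N) (Fin N) (mixedSpace E)) =
      ∑ i, traceFormC N ((e X i : skewC N (Jw i)) : Matrix (Fin N) (Fin N) ℂ) ((e Y i : skewC N (Jw i)) : Matrix (Fin N) (Fin N) ℂ))
    {κ : ι → Type} [∀ i, Fintype (κ i)] [∀ i, DecidableEq (κ i)] (b : ∀ i, Module.Basis (κ i) ℝ (skewC N (Jw i))) :
    lieGram J ((Pi.basis b).map e.symm.toLinearEquiv) = Matrix.blockDiagonal' fun i => lieGramC (b i) := by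
  ext ⟨s, k⟩ ⟨s', l⟩
  rw [lieGram_apply, htr]
  simp only [Module.Basis.map_apply, ContinuousLinearEquiv.coe_toLinearEquiv, ContinuousLinearEquiv.apply_symm_apply, Pi.basis_apply]
  by_cases h : s = s'
  · subst h
    rw [Matrix.blockDiagonal'_apply_eq, lieGramC_apply, Finset.sum_eq_single s]
    · rw [Pi.single_eq_same, Pi.single_eq_same]
    · intro i _ his
      rw [Pi.single_eq_of_ne his, ZeroMemClass.coe_zero, LinearMap.map_zero, LinearMap.zero_apply]
    · intro hs; exact absurd (Finset.mem_univ s) hs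
  · rw [Matrix.blockDiagonal'_apply_ne _ _ _ h]
    refine Finset.sum_eq_zero fun i _ => ?_
    by_cases his : i = s
    · subst his
      rw [Pi.single_eq_of_ne h, ZeroMemClass.coe_zero, LinearMap.map_zero]
    · rw [Pi.single_eq_of_ne his, ZeroMemClass.coe_zero, LinearMap.map_zero, LinearMap.zero_apply]

/-- Hence `det Gram(B) = ∏_i lieGramDetC (Jw i)` for the pull-back of the bases of record. [cite: Macdonald1980, p. 93] -/
theorem det_lieGram_pullback_pi_basis (e : archSkew F E c N J ≃L[ℝ] (∀ i, skewC N (Jw i)))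
    (htr : ∀ X Y : archSkew F E c N J, traceForm E N (X : Matrix (Fin N) (Fin N) (mixedSpace E)) (Y : Matrix (Fin N) (Fin N) (mixedSpace E)) =
      ∑ i, traceFormC N ((e X i : skewC N (Jw i)) : Matrix (Fin N) (Fin N) ℂ) ((e Y i : skewC N (Jw i)) : Matrix (Fin N) (Fin N) ℂ)) :
    (lieGram J ((Pi.basis fun i => lieFinBasisC N (Jw i)).map e.symm.toLinearEquiv)).det =
      ∏ i, lieGramDetC N (Jw i) := by
  rw [lieGram_pullback_pi_basis_eq e htr, det_blockDiagonal'_pi]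
  rfl

/-- **(E3) NON-DEGENERACY DESCENDS TO EVERY PLACE**: `lieGramDet J ≠ 0 ⇒ lieGramDetC (Jw i) ≠ 0` (the two Gram determinants of `𝔲(J)` differ by the square of a change-of-basis
determinant, and a non-zero product has non-zero factors). [cite: Macdonald1980, p. 93] [cite: Knapp2002, VIII §2] -/
theorem lieGramDetC_ne_zero_of_lieGramDet_ne_zero (e : archSkew F E c N J ≃L[ℝ] (∀ i, skewC N (Jw i)))
    (htr : ∀ X Y : archSkew F E c N J, traceForm E N (X : Matrix (Fin N) (Fin N) (mixedSpace E)) (Y : Matrix (Fin N) (Fin N) (mixedSpace E)) =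
      ∑ i, traceFormC N ((e X i : skewC N (Jw i)) : Matrix (Fin N) (Fin N) ℂ) ((e Y i : skewC N (Jw i)) : Matrix (Fin N) (Fin N) ℂ))
    (hnd : lieGramDet F E c N J ≠ 0) (i : ι) : lieGramDetC N (Jw i) ≠ 0 := by
  haveI : FiniteDimensional ℝ (Matrix (Fin N) (Fin N) (mixedSpace E)) := finiteDimensional_matrix
  set B := (Pi.basis fun i => lieFinBasisC N (Jw i)).map e.symm.toLinearEquiv with hB
  -- reindex the basis of record to `B`'s index type, then change basis: `det Gram(B) = det(P)² · lieGramDet ≠ 0`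
  set B₀ := lieFinBasis F E c N J with hB₀
  set B₁ := B₀.reindex (B₀.indexEquiv B) with hB₁
  have hG : (lieGram J B₁).det = lieGramDet F E c N J := by
    have h1 : lieGram J B₁ = Matrix.reindex (B₀.indexEquiv B) (B₀.indexEquiv B) (lieGram J B₀) := by
      ext i j; simp only [lieGram_apply, hB₁, Module.Basis.reindex_apply, Matrix.reindex_apply, Matrix.submatrix_apply]
    rw [h1, Matrix.det_reindex_self]
    rfl
  have hprod : (lieGram J B).det ≠ 0 := by
    rw [lieGram_basis_change J B₁ B, Matrix.det_mul, Matrix.det_mul, Matrix.det_transpose, hG]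
    have hP : (B₁.toMatrix B).det ≠ 0 := by
      rw [← Module.Basis.det_apply]; exact (B₁.isUnit_det B).ne_zero
    exact mul_ne_zero (mul_ne_zero hP hnd) hP
  rw [hB, det_lieGram_pullback_pi_basis e htr] at hprod
  exact (Finset.prod_ne_zero_iff.1 hprod) i (Finset.mem_univ i)

/-- `√|∏ x| = ∏ √|x|`, in `ℝ≥0∞`. [cite: Folland1995, §2.2] -/
theorem ofReal_sqrt_abs_prod {ι : Type*} (s : Finset ι) (x : ι → ℝ) :
    ENNReal.ofReal (Real.sqrt |∏ i ∈ s, x i|) = ∏ i ∈ s, ENNReal.ofReal (Real.sqrt |x i|) := by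
  rw [Finset.abs_prod, Real.sqrt_prod _ fun i _ => abs_nonneg _, ENNReal.ofReal_prod_of_nonneg fun i _ => Real.sqrt_nonneg _]

variable [MeasurableSpace (archSkew F E c N J)] [BorelSpace (archSkew F E c N J)] [∀ i, MeasurableSpace (skewC N (Jw i))] [∀ i, BorelSpace (skewC N (Jw i))]

/-- **(E1) THE CANONICAL LEBESGUE MEASURE SPLITS ALONG THE PLACES**: `e_* (lieStdLebesgue J) = ⊗_i lieStdLebesgueC (Jw i)` for every continuous linear splitting `e` through
which the trace form is the sum of the place trace forms. [cite: Rogawski1990, §1.7 p. 6] [cite: Macdonald1980, p. 93] [cite: Folland1995, §2.2] -/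
theorem map_lieStdLebesgue_eq_pi (e : archSkew F E c N J ≃L[ℝ] (∀ i, skewC N (Jw i)))
    (htr : ∀ X Y : archSkew F E c N J, traceForm E N (X : Matrix (Fin N) (Fin N) (mixedSpace E)) (Y : Matrix (Fin N) (Fin N) (mixedSpace E)) =
      ∑ i, traceFormC N ((e X i : skewC N (Jw i)) : Matrix (Fin N) (Fin N) ℂ) ((e Y i : skewC N (Jw i)) : Matrix (Fin N) (Fin N) ℂ)) :
    (lieStdLebesgue F E c N J).map e = Measure.pi fun i => lieStdLebesgueC N (Jw i) := by
  haveI : FiniteDimensional ℝ (Matrix (Fin N) (Fin N) (mixedSpace E)) := finiteDimensional_matrix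
  haveI : FiniteDimensional ℝ (Matrix (Fin N) (Fin N) ℂ) := finiteDimensional_matrixC
  haveI : ∀ i, FiniteDimensional ℝ (skewC N (Jw i)) := fun i => inferInstance
  haveI : ∀ i, SecondCountableTopology (skewC N (Jw i)) := fun i => inferInstance
  -- the determinant of the pulled-back assembled basis (before naming it)
  have hdet := det_lieGram_pullback_pi_basis e htr
  set B := (Pi.basis fun i => lieFinBasisC N (Jw i)).map e.symm.toLinearEquiv with hB
  -- the pulled-back assembled basis maps to the assembled basis
  have hBmap : B.map e.toLinearEquiv = Pi.basis fun i => lieFinBasisC N (Jw i) := by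
    refine Module.Basis.eq_of_apply_eq fun p => ?_
    rw [Module.Basis.map_apply, hB, Module.Basis.map_apply, ContinuousLinearEquiv.coe_toLinearEquiv, ContinuousLinearEquiv.coe_toLinearEquiv,
      ContinuousLinearEquiv.apply_symm_apply]
  have hmapB : (B.addHaar).map e = Measure.pi fun i => (lieFinBasisC N (Jw i)).addHaar := by
    rw [Module.Basis.map_addHaar B e, hBmap, pi_basis_addHaar]
  -- the place measures are `√|lieGramDetC| • (lieFinBasisC).addHaar`, and `Measure.pi` pulls the constants out
  have hC : (fun i => lieStdLebesgueC N (Jw i)) = fun i => (Real.sqrt |lieGramDetC N (Jw i)|).toNNReal • (lieFinBasisC N (Jw i)).addHaar := by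
    funext i
    rw [lieStdLebesgueC_def, ENNReal.smul_def, ENNReal.ofReal]
    rfl
  have hR : (Measure.pi fun i => lieStdLebesgueC N (Jw i)) = (∏ i, ENNReal.ofReal (Real.sqrt |lieGramDetC N (Jw i)|)) • Measure.pi fun i => (lieFinBasisC N (Jw i)).addHaar := by
    rw [hC, pi_smul_measure]
    rfl
  rw [lieStdLebesgue_eq_smul_addHaar J B, Measure.map_smul, hmapB, hR, ← ofReal_sqrt_abs_prod]
  -- the two `det`s differ only in the `DecidableEq` instance on the index type (classical in ★ `lieStdLebesgue_eq_smul_addHaar`)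
  congr 4
  convert hdet using 2

/-! ## §2 The Cayley weight along the splitting -/

omit [MeasurableSpace (archSkew F E c N J)] [BorelSpace (archSkew F E c N J)] [∀ i, MeasurableSpace (skewC N (Jw i))] [∀ i, BorelSpace (skewC N (Jw i))] in
/-- **(E2) THE CAYLEY WEIGHT IS THE PRODUCT OF THE PLACE CAYLEY WEIGHTS**: if `e` intertwines `skewMulL X` with `⊕_i skewMulLC (e X i)` (`hmul`), then
`cayleyWeight X = ∏_i cayleyWeightC (e X i)` (`det` is conjugation-invariant and multiplicative over direct sums of different ranks). [cite: Rogawski1990, §1.7 p. 6] [cite: Knapp2002, VIII §2] -/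
theorem cayleyWeight_eq_prod (e : archSkew F E c N J ≃L[ℝ] (∀ i, skewC N (Jw i)))
    (hmul : ∀ (X Y : archSkew F E c N J) (i : ι), e (skewMulL F E c N J X Y) i = skewMulLC N (Jw i) (e X i) (e Y i))
    (X : archSkew F E c N J) :
    cayleyWeight F E c N J X = ∏ i, cayleyWeightC N (Jw i) (e X i) := by
  haveI : FiniteDimensional ℝ (Matrix (Fin N) (Fin N) (mixedSpace E)) := finiteDimensional_matrix
  haveI : FiniteDimensional ℝ (Matrix (Fin N) (Fin N) ℂ) := finiteDimensional_matrixC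
  -- `e ∘ skewMulL X ∘ e⁻¹ = ⊕_i skewMulLC (e X i)` as linear maps
  have hconj : e.toLinearEquiv.conj (skewMulL F E c N J X : archSkew F E c N J →ₗ[ℝ] archSkew F E c N J) =
      LinearMap.pi fun i => ((skewMulLC N (Jw i) (e X i) : skewC N (Jw i) →ₗ[ℝ] skewC N (Jw i))).comp (LinearMap.proj i) := by
    refine LinearMap.ext fun Z => funext fun i => ?_
    rw [LinearEquiv.conj_apply_apply, ContinuousLinearEquiv.coe_toLinearEquiv, ContinuousLinearEquiv.coe_symm_toLinearEquiv, ContinuousLinearMap.coe_coe, hmul,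
      ContinuousLinearEquiv.apply_symm_apply]
    rfl
  simp only [cayleyWeight_def, cayleyWeightC_def, ContinuousLinearMap.det]
  have hdet : LinearMap.det (skewMulL F E c N J X : archSkew F E c N J →ₗ[ℝ] archSkew F E c N J) = ∏ i, LinearMap.det (skewMulLC N (Jw i) (e X i) : skewC N (Jw i) →ₗ[ℝ] skewC N (Jw i)) := by
    rw [← LinearMap.det_conj (skewMulL F E c N J X : archSkew F E c N J →ₗ[ℝ] archSkew F E c N J) e.toLinearEquiv, ← det_pi_pi, ← hconj, LinearEquiv.conj_apply]
    rfl
  rw [hdet, Finset.abs_prod, Finset.prod_inv_distrib]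

end Splitting

end UnitaryArchTopForm

end Literature.NumberTheory.Weil1964

end
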